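import Summits.CriticalPhenomena.SAWScalingLimit.Theorems.SAWLoopFugacityFlowAvoidanceLimitInteriorRatioLimitSubharmonic
import Literature.Probability.LatticeModels.WeakBeurlingHoleFree
import Literature.Probability.LatticeModels.ExteriorLatticePath
import Literature.Probability.LatticeModels.BoundaryEstimate
import Literature.Probability.LatticeModels.PlanarIsing

/-!
# Weak Beurling estimate (Hölder decay at a boundary point) for harmonic functions of the edge-killed walk
— UBHP step-zero brick B-beur of line `symplectic-fermion-anchor`
(crux `SAWLoopFugacityFlow.AvoidanceLimit`, stmt-CriticalPhenomena-10649)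

The uniform boundary Harnack principle `stub_uniformBHP` of the line concerns nonnegative functions
`h : Λ → ℝ` on the volume `Λ = meshDomainFinset D δ` of a Jordan domain `D` that are harmonic for the
EDGE-killed simple random walk of `Ω_δ = discreteDomainGraph D δ`, i.e. `(P h)(x) = h(x)` with
`P = ¼·adjMat Ω_δ Λ`. Its step zero (Chelkak–Wan 2021, §3.2, before Lemma 3.7; Smirnov 2010, App. B,
Lemma B.2; Kesten 1987) is the WEAK BEURLING estimate proved here:

* `transitionHarmonic_weakBeurling` (registered signature) — for a boundary point `p` of `D` and
  `R, ε > 0` there is `r > 0` such that for all small meshes `δ`, every `h ≥ 0` on `Λ`, `P`-harmonic at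
  the vertices within `R` of `p` and bounded by `M`, satisfies `h ≤ ε M` at the vertices within `r` of `p`.

Proof. Only an UPPER bound is needed, so the edge/site-killing discrepancy is harmless: the zero
extension of `h` off `Λ` is SUBharmonic for the nearest-neighbour Laplacian of `ℤ²` wherever `h` is
`P`-harmonic (the `Ω_δ`-neighbours are among the four lattice neighbours and the dropped terms are
`≥ 0`). The tree's comparison-plus-weak-Beurling lemma `sub_le_eta_add_pow` (`BoundaryEstimate.lean`,
built on `weakBeurling_of_holeFree`) is then applied to `h/M` inside the hole-free set
`K = (ExtConn D δ)ᶜ` (`holeFree_compl_extConn`), with the exterior site `F₀ ∈ ExtConn D δ` near `p`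
supplied by `eventually_exists_extConn_near`; all scales (`J` with `(1 - c_*)^J < ε`, the radius
`r = R / (40·5^J)`, the boxes of radii `12k₀` and `10·5^J k₀`, `k₀ = ⌈r/δ⌉`) are fixed before `δ → 0`.

Sources: S. Smirnov, Ann. of Math. 172 (2010), App. B, Lemma B.2 [Smirnov2010]; H. Kesten, Stoch. Proc.
Appl. 25 (1987) [Kesten1987]; D. Chelkak, Y. Wan, Electron. J. Probab. 26 (2021), §3.2 [ChelkakWan2021].
No definitions; the general subharmonicity dictionary, the exit representation and the interior Harnack
inequality of the programme are sibling files and are NOT restated here (the subharmonicity used below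
is a private copy of the Green's-column pattern `greenEntry_subharmonicOn`).
-/

noncomputable section

open scoped BigOperators Topology Classical
open Filter Finset
open Literature.Probability.RandomPlanarGeometry Literature.Probability.LatticeModels

namespace Summit.CriticalPhenomena.SAWScalingLimit.Theorems.AvoidanceLimit.Anchor

open KilledGreen

/-! ## Subharmonicity of the zero extension (private copy of the Green's-column pattern) -/

/-- The zero extension off `Λ` of a nonnegative `h : Λ → ℝ` that is `P_{H|Λ}`-harmonic at the
vertices of `Λ` in `T` (`H ≤ ℤ²`) is lattice-subharmonic on `T`: at `v ∈ Λ ∩ T` the four lattice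
neighbours contain the `H|_Λ`-neighbours and the dropped terms are `≥ 0`; at `v ∈ T ∖ Λ` the value is
`0 ≤` the neighbour sum. [folklore] -/
private theorem zeroExt_subharmonicOn {H : SimpleGraph (Site 2)} (hH : H ≤ zdGraph 2)
    (Λ : Finset (Site 2)) {T : Set (Site 2)} {h : ↥Λ → ℝ} (hnn : ∀ x, 0 ≤ h x)
    (hharm : ∀ x : ↥Λ, (x : Site 2) ∈ T → Matrix.mulVec ((4 : ℝ)⁻¹ • adjMat H Λ) h x = h x) :
    IsLatticeSubharmonicOn (fun v => if hv : v ∈ Λ then h ⟨v, hv⟩ else 0) T := by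
  set g : Site 2 → ℝ := fun v => if hv : v ∈ Λ then h ⟨v, hv⟩ else 0 with hg
  have hg0 : ∀ z, 0 ≤ g z := fun z => by
    by_cases hz : z ∈ Λ
    · simp only [hg, hz, dite_true]; exact hnn _
    · simp [hg, hz]
  intro v hv
  rw [latticeLaplacian_eq, sum_cornerUnit_eq_sum_neighborFinset v g]
  by_cases hvΛ : v ∈ Λ
  · -- at a vertex of `Λ`: `h v = (P h) v ≤ ¼ Σ_{lattice nbrs} g`
    have key : h ⟨v, hvΛ⟩ ≤ 4⁻¹ * ∑ z ∈ (zdGraph 2).neighborFinset v, g z := by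
      rw [← hharm ⟨v, hvΛ⟩ hv, transition_mulVec_apply]
      refine mul_le_mul_of_nonneg_left ?_ (by norm_num)
      have h1 : ∑ y ∈ univ.filter (fun y : ↥Λ => H.Adj v y.1), h y =
          ∑ z ∈ (univ.filter (fun y : ↥Λ => H.Adj v y.1)).map (Function.Embedding.subtype _), g z := by
        rw [Finset.sum_map]
        refine Finset.sum_congr rfl fun y _ => ?_
        simp [hg]
      rw [h1]
      exact Finset.sum_le_sum_of_subset_of_nonneg (map_filter_adj_subset Λ hH ⟨v, hvΛ⟩)
        fun z _ _ => hg0 z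
    have h4 : g v = h ⟨v, hvΛ⟩ := by simp [hg, hvΛ]
    rw [h4]
    linarith
  · have h0 : g v = 0 := by simp [hg, hvΛ]
    rw [h0, mul_zero, sub_zero]
    exact Finset.sum_nonneg fun z _ => hg0 z

/-! ## The lattice statement: subharmonic comparison plus the hole-free weak Beurling estimate -/

/-- **Pure lattice form.** Let `H ≤ ℤ²`, `h ≥ 0` on `Λ` be `P_{H|Λ}`-harmonic at the vertices in `T`
and bounded by `M > 0`; let `K ⊇ T` be hole-free, `F₀ ∉ K` a site of the box `mB c k₀`, and suppose
every vertex of `Λ` in the big box `sqBox c Rb` lies in `T`, with `10·5^J k₀ ≤ Rb`. Then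
`h ≤ (1 - c_*)^J · M` at the vertices of `T ∩ mB c k₀ ∩ sqBox c Rb`: the comparison lemma
`sub_le_eta_add_pow` (with `η₁ = 0`) applied to the subharmonic zero extension of `h/M`.
[cite: Smirnov2010, Lemma B.2] -/
private theorem zeroExt_le_pow_mul {H : SimpleGraph (Site 2)} (hH : H ≤ zdGraph 2)
    (Λ : Finset (Site 2)) {T K : Set (Site 2)} {h : ↥Λ → ℝ} (hnn : ∀ x, 0 ≤ h x)
    (hharm : ∀ x : ↥Λ, (x : Site 2) ∈ T → Matrix.mulVec ((4 : ℝ)⁻¹ • adjMat H Λ) h x = h x)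
    {M : ℝ} (hM : 0 < M) (hle : ∀ x, h x ≤ M) (hK : HoleFree K) (hTK : T ⊆ K) (c : Site 2)
    {k₀ : ℕ} (hk₀ : 0 < k₀) {F₀ : Site 2} (hF₀ : F₀ ∉ K) (hF₀c : F₀ ∈ mB c k₀) {Rb : ℤ}
    (hbox : ∀ x ∈ WeakBeurling.sqBox c Rb, x ∈ Λ → x ∈ T) (J : ℕ)
    (hJ : 10 * 5 ^ J * (k₀ : ℤ) ≤ Rb) (z : ↥Λ) (hzT : (z : Site 2) ∈ T)
    (hzR : (z : Site 2) ∈ WeakBeurling.sqBox c Rb) (hzc : (z : Site 2) ∈ mB c k₀) :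
    h z ≤ (1 - maneuverConst) ^ J * M := by
  set g : Site 2 → ℝ := fun v => if hv : v ∈ Λ then h ⟨v, hv⟩ else 0 with hg
  have hgM : ∀ y, g y ≤ M := fun y => by
    by_cases hy : y ∈ Λ
    · simp only [hg, hy, dite_true]; exact hle _
    · simp only [hg, hy, dite_false]; exact hM.le
  have hu1 : ∀ y, M⁻¹ * g y ≤ 1 := fun y => by
    rw [inv_mul_le_iff₀ hM, mul_one]; exact hgM y
  have hsub : IsLatticeSubharmonicOn (fun y => M⁻¹ * g y) T := fun v hv => by
    rw [latticeLaplacian_const_mul]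
    exact mul_nonneg (inv_nonneg.2 hM.le) (zeroExt_subharmonicOn hH Λ hnn hharm v hv)
  have hfin : (T ∩ WeakBeurling.sqBox c Rb).Finite :=
    (WeakBeurling.sqBox_finite c Rb).subset Set.inter_subset_right
  have key := sub_le_eta_add_pow (S₀ := T) (Bl := WeakBeurling.sqBox c Rb) (K := K) hsub le_rfl
    (fun w hwT _ => by
      split_ifs with hwB
      · have hwΛ : w ∉ Λ := fun hwΛ => hwT (hbox w hwB hwΛ)
        simp [hg, hwΛ]
      · exact hu1 w)
    (fun w _ => hu1 w) hfin hK (Set.inter_subset_left.trans hTK) c hk₀ hF₀ hF₀c subset_rfl J hJ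
    ⟨hzT, hzR⟩ hzc
  rw [zero_add] at key
  have hgz : g z = h z := by simp [hg]
  have key' : M⁻¹ * g z ≤ (1 - maneuverConst) ^ J := key
  rw [inv_mul_le_iff₀ hM, hgz] at key'
  linarith

/-! ## Registered brick B-beur -/

/-- **Weak Beurling estimate / Hölder decay at a boundary point for the edge-killed walk**
(registered brick B-beur of `stub_uniformBHP`). For a Jordan domain `D`, a boundary point `p` and
`R, ε > 0` there is `r > 0` such that, for all small meshes `δ > 0`, every nonnegative
`h : Λ → ℝ` (`Λ = meshDomainFinset D δ`) which is harmonic for the transition matrix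
`P = ¼·adjMat (discreteDomainGraph D δ) Λ` of the EDGE-killed `Ω_δ`-walk at every vertex within `R` of
`p`, and which is bounded by `M`, satisfies `h z ≤ ε M` at every vertex `z` within `r` of `p`. Proof:
subharmonic zero extension, harmonic majorant and the hole-free weak Beurling estimate inside
`(ExtConn D δ)ᶜ` with an exterior site near `p` (`eventually_exists_extConn_near`), all scales fixed
before `δ → 0`. [cite: Smirnov2010, Lemma B.2] -/
theorem transitionHarmonic_weakBeurling :
    ∀ (D : JordanDomain) (p : ℂ), p ∈ frontier D.carrier → ∀ R : ℝ, 0 < R → ∀ ε : ℝ, 0 < ε → ∃ r : ℝ, 0 < r ∧ ∀ᶠ δ in 𝓝[>] (0 : ℝ), ∀ h : ↥(meshDomainFinset D.carrier δ) → ℝ, (∀ x, 0 ≤ h x) → (∀ x : ↥(meshDomainFinset D.carrier δ), dist (meshPoint δ x) p < R → Matrix.mulVec ((4 : ℝ)⁻¹ • adjMat (discreteDomainGraph D.carrier δ) (meshDomainFinset D.carrier δ)) h x = h x) → ∀ M : ℝ, (∀ x, h x ≤ M) → ∀ z : ↥(meshDomainFinset D.carrier δ), dist (meshPoint δ z) p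 < r → h z ≤ ε * M := by
  intro D p hp R hR ε hε
  -- the number of scales `J` and the radius `ρ₀ = R / (40 · 5^J)`
  obtain ⟨J, hJε⟩ := exists_pow_lt_of_lt_one hε
    (show 1 - maneuverConst < 1 by linarith [maneuverConst_pos])
  have hN1 : (1 : ℝ) ≤ 5 ^ J := one_le_pow₀ (by norm_num)
  obtain ⟨ρ₀, hρ₀pos, hρ₀⟩ : ∃ ρ₀ : ℝ, 0 < ρ₀ ∧ 20 * 5 ^ J * ρ₀ = R / 2 :=
    ⟨R / (40 * 5 ^ J), by positivity, by field_simp; ring⟩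
  have hρ₀R : ρ₀ < R := by nlinarith
  refine ⟨ρ₀, hρ₀pos, ?_⟩
  have hsmall : ∀ᶠ δ in 𝓝[>] (0 : ℝ), δ < R / (40 * 5 ^ J + 2) :=
    nhdsWithin_le_nhds (Iio_mem_nhds (by positivity))
  filter_upwards [hsmall, (self_mem_nhdsWithin : ∀ᶠ δ in 𝓝[>] (0 : ℝ), 0 < δ),
    eventually_exists_extConn_near D hp hρ₀pos] with δ hδs hδ0 hF
  have hδ : (0 : ℝ) < δ := hδ0
  have hδR : (40 * 5 ^ J + 2) * δ < R := by
    rw [lt_div_iff₀ (by positivity)] at hδs; linarith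
  obtain ⟨F₀, hF₀d, hF₀e⟩ := hF
  intro h hnn hharm M hle z hz
  -- degenerate bound `M ≤ 0`
  rcases le_or_gt M 0 with hM0 | hMpos
  · have hM : M = 0 := le_antisymm hM0 ((hnn z).trans (hle z))
    rw [hM, mul_zero]
    linarith [hle z]
  -- the centre and the unit scale `k₀` with `ρ₀ ≤ k₀ δ < ρ₀ + δ`
  obtain ⟨c, hcp⟩ : ∃ c : Site 2, dist (meshPoint δ c) p ≤ δ := ⟨_, dist_meshPoint_nearestSite_le hδ p⟩
  obtain ⟨k₀, hk₀pos, hk₁, hk₂⟩ : ∃ k₀ : ℕ, 0 < k₀ ∧ ρ₀ ≤ k₀ * δ ∧ (k₀ : ℝ) * δ < ρ₀ + δ := by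
    refine ⟨⌈ρ₀ / δ⌉₊, Nat.ceil_pos.2 (by positivity), ?_, ?_⟩
    · have h1 := Nat.le_ceil (ρ₀ / δ)
      rwa [div_le_iff₀ hδ] at h1
    · have h1 := Nat.ceil_lt_add_one (show (0 : ℝ) ≤ ρ₀ / δ by positivity)
      calc ((⌈ρ₀ / δ⌉₊ : ℕ) : ℝ) * δ < (ρ₀ / δ + 1) * δ := mul_lt_mul_of_pos_right h1 hδ
        _ = ρ₀ + δ := by field_simp
  have hk0z : (0 : ℤ) < k₀ := by exact_mod_cast hk₀pos
  -- sites within `ρ₀` of `p` are in the small box `mB c k₀` and in the big box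
  have hnear : ∀ y : Site 2, dist (meshPoint δ y) p < ρ₀ →
      y ∈ mB c k₀ ∧ y ∈ WeakBeurling.sqBox c (10 * 5 ^ J * (k₀ : ℤ)) := by
    intro y hy
    have hyc : dist (meshPoint δ y) (meshPoint δ c) < ρ₀ + δ :=
      calc dist (meshPoint δ y) (meshPoint δ c) ≤ dist (meshPoint δ y) p + dist (meshPoint δ c) p :=
            dist_triangle_right _ _ _
        _ < ρ₀ + δ := add_lt_add_of_lt_of_le hy hcp
    have hcoord : ∀ i : Fin 2, |y i - c i| ≤ (k₀ : ℤ) := by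
      intro i
      have h1 := abs_sub_mul_le_dist_meshPoint' δ c y i
      rw [abs_of_pos hδ] at h1
      have h2 : δ * |((y i : ℤ) : ℝ) - c i| < δ * (k₀ + 1) := by nlinarith
      have h3 : |((y i : ℤ) : ℝ) - c i| < k₀ + 1 := lt_of_mul_lt_mul_left h2 hδ.le
      have h4 : |y i - c i| < (k₀ : ℤ) + 1 := by exact_mod_cast h3
      exact Int.lt_add_one_iff.1 h4
    have hRk : (k₀ : ℤ) ≤ 10 * 5 ^ J * (k₀ : ℤ) := by
      have h5 : (1 : ℤ) ≤ 5 ^ J := one_le_pow₀ (by norm_num)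
      nlinarith
    refine ⟨?_, ?_⟩
    · rw [mB_eq_sqBox, WeakBeurling.mem_sqBox]
      exact ⟨(hcoord 0).trans (by linarith), (hcoord 1).trans (by linarith)⟩
    · rw [WeakBeurling.mem_sqBox]
      exact ⟨(hcoord 0).trans hRk, (hcoord 1).trans hRk⟩
  -- every site of the big box is within `R` of `p`
  have hfar : ∀ x ∈ WeakBeurling.sqBox c (10 * 5 ^ J * (k₀ : ℤ)), dist (meshPoint δ x) p < R := by
    intro x hx
    rw [WeakBeurling.mem_sqBox] at hx
    have hsup : DiscreteDobrushin.supNear c (10 * 5 ^ J * (k₀ : ℤ)) x := fun i => by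
      fin_cases i
      · exact hx.1
      · exact hx.2
    have h1 := DiscreteDobrushin.dist_meshPoint_le_of_supNear hδ.le hsup
    push_cast at h1
    have h2 : (5 : ℝ) ^ J * (k₀ * δ) ≤ 5 ^ J * (ρ₀ + δ) :=
      mul_le_mul_of_nonneg_left hk₂.le (by positivity)
    calc dist (meshPoint δ x) p ≤ dist (meshPoint δ x) (meshPoint δ c) + dist (meshPoint δ c) p :=
          dist_triangle _ _ _
      _ < R := by nlinarith
  -- the volume, the region `T` of harmonicity and the hole-free certificate
  have hΛD : ∀ v : Site 2, v ∈ meshDomainFinset D.carrier δ → meshPoint δ v ∈ D.carrier := by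
    intro v hv
    have h1 : v ∈ (meshDomainFinset D.carrier δ : Set (Site 2)) := hv
    rw [coe_meshDomainFinset D.isBounded hδ] at h1
    exact meshDomain_subset_meshVertices _ _ h1
  set T : Set (Site 2) := {v | v ∈ meshDomainFinset D.carrier δ ∧ dist (meshPoint δ v) p < R} with hT
  have hTK : T ⊆ (ExtConn D.carrier δ)ᶜ := fun v hv => not_mem_extConn_of_mem (hΛD v hv.1)
  have hF₀K : F₀ ∉ (ExtConn D.carrier δ)ᶜ := fun h' => h' hF₀e
  have hH : discreteDomainGraph D.carrier δ ≤ zdGraph 2 :=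
    (discreteDomainGraph_le_meshGraph _ _).trans (meshGraph_le_zdGraph _ _)
  have hharmT : ∀ x : ↥(meshDomainFinset D.carrier δ), (x : Site 2) ∈ T →
      Matrix.mulVec ((4 : ℝ)⁻¹ • adjMat (discreteDomainGraph D.carrier δ)
        (meshDomainFinset D.carrier δ)) h x = h x := fun x hx => hharm x hx.2
  have hbox : ∀ x ∈ WeakBeurling.sqBox c (10 * 5 ^ J * (k₀ : ℤ)),
      x ∈ meshDomainFinset D.carrier δ → x ∈ T := fun x hx hxΛ => ⟨hxΛ, hfar x hx⟩
  obtain ⟨hzc, hzR⟩ := hnear z hz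
  have hzT : (z : Site 2) ∈ T := ⟨z.2, hz.trans hρ₀R⟩
  have key := zeroExt_le_pow_mul hH (meshDomainFinset D.carrier δ) hnn hharmT hMpos hle
    (holeFree_compl_extConn D.carrier δ) hTK c hk₀pos hF₀K (hnear F₀ hF₀d).1 hbox J le_rfl z hzT
    hzR hzc
  calc h z ≤ (1 - maneuverConst) ^ J * M := key
    _ ≤ ε * M := mul_le_mul_of_nonneg_right hJε.le hMpos.le

end Summit.CriticalPhenomena.SAWScalingLimit.Theorems.AvoidanceLimit.Anchor

end
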